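import Mathlib
import Literature.Analysis.OperatorTheory.HolomorphicConeFamily
import Literature.Analysis.OperatorTheory.KernelNormIdentity
import HarnessLib

/-!
# Operator chains of the Osterwalder–Schrader calculus in a rotating frame

The bookkeeping of the analytic continuation of Euclidean correlation functions in the ANGLE of a
rotation, `θ ↦ S(R_θ x)`, by the Osterwalder–Schrader operator calculus of a fixed time direction
(Glimm–Jaffe, *Quantum Physics* (1987), §19.5–19.7: analyticity of Schwinger functions in complex
Euclidean transformations from the light cone of the transfer matrix; Streater, CMP 26 (1972)).
A point `x = (a, b, w)` (planar coordinates `(a, b)` in the rotation plane, `w` along the axis) has,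
at the complex angle `ζ`, the complexified time coordinate `τ(ζ) = cos ζ · a + sin ζ · b` and
transverse coordinate `ς(ζ) = -sin ζ · a + cos ζ · b`; between consecutive points (ordered by real
time) sits the gap operator `N(Δτ - reserved, Δς)` of a holomorphic cone family
(`HolomorphicConeFamily`), and at each inserted point a bounded insertion operator `B_w` which
reserves the time `u` on both sides. Abstract setting: kernel vectors `δ : X → H`, an operator family
`N : ℂ × ℂ → (H →L[ℂ] H)`, insertions `B : ℝ → (H →L[ℂ] H)`.

## Contents (namespace `Literature.MathematicalPhysics.QuantumFieldTheory`; all proved)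

* `ChainItem` (`a b w : ℝ`, `ins : Bool`), its coordinates `t, s` (real angle), `τ, ς` (complex
  angle), the reservation `res u`, the gap `gap u Q P ζ ∈ ℂ × ℂ`; `re_τ_sub`, `im_ς_sub` (a complex
  angle `θ + iχ` BOOSTS the gaps: `Re Δτ = cosh χ · Δt`, `Im Δς = -sinh χ · Δt`) and
  `gap_mem_tube` (the gap stays in the tube `|Im Δς| < Re Δτ - reserved` iff
  `e^{-|χ|} Δt > reserved`: speed one is exactly the threshold).
* `chainOp N B u L Q ζ` (the operator of the list `L` seen from the reference item `Q`) and
  `chainCfg σ κ u L Q θ x` (the index reached at a real angle when `N(t,y)` relabels by `σ t y` and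
  `B w` by `κ w`); `differentiableOn_chainOp` (norm holomorphy), `norm_chainOp_apply_le`,
  `conjOp_chainOp_apply` (`J X(ζ̄) = X(ζ) J`), `chainOp_apply_gen` (real angles reproduce kernel
  vectors).
(The norm identity for real-symmetric holomorphic vector families that controls the block norms is
`KernelVectors.inner_self_eq_of_conjOp_eq` in `Literature/Analysis/OperatorTheory/KernelNormIdentity`.)

## References
* J. Glimm, A. Jaffe, *Quantum Physics* (2nd ed. 1987), §19.5–19.7.
* R. F. Streater, CMP 26 (1972) 109–120.
-/

noncomputable section

open Filter ComplexConjugate Complex Set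
open scoped InnerProductSpace Topology
open Literature.Analysis.OperatorTheory Literature.Analysis.OperatorTheory.KernelVectors
  Literature.Analysis.Complex

namespace Literature.MathematicalPhysics.QuantumFieldTheory

/-! ## Items and their boosted coordinates -/

/-- An item of an operator chain: a point with planar coordinates `(a, b)` in the rotation plane and
coordinate `w` along the rotation axis, carrying a field insertion (`ins = true`) or serving as a
virtual reference point (`ins = false`). [folklore] -/
structure ChainItem where
  /-- first planar coordinate (the time coordinate at angle `0`) -/
  a : ℝ
  /-- second planar coordinate (the transverse coordinate at angle `0`) -/
  b : ℝ
  /-- coordinate along the rotation axis -/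
  w : ℝ
  /-- whether a field is inserted at this point -/
  ins : Bool

namespace ChainItem

/-- Time coordinate of the rotated point at the real angle `θ`: `cos θ · a + sin θ · b`. [folklore] -/
def t (P : ChainItem) (θ : ℝ) : ℝ := Real.cos θ * P.a + Real.sin θ * P.b

/-- Transverse coordinate of the rotated point at the real angle `θ`: `-sin θ · a + cos θ · b`. [folklore] -/
def s (P : ChainItem) (θ : ℝ) : ℝ := -Real.sin θ * P.a + Real.cos θ * P.b

/-- Complexified time coordinate at the complex angle `ζ`. [folklore] -/
def τ (P : ChainItem) (ζ : ℂ) : ℂ := Complex.cos ζ * P.a + Complex.sin ζ * P.b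

/-- Complexified transverse coordinate at the complex angle `ζ`. [folklore] -/
def ς (P : ChainItem) (ζ : ℂ) : ℂ := -Complex.sin ζ * P.a + Complex.cos ζ * P.b

/-- The time reserved at an item for the insertion operator: `u` if inserted, `0` if virtual. [folklore] -/
def res (u : ℝ) (P : ChainItem) : ℝ := if P.ins then u else 0

/-- The complex gap parameter `(Δτ - reserved, Δς)` between consecutive items `Q` (earlier) and
`P` (later) at the complex angle `ζ`. [folklore] -/
def gap (u : ℝ) (Q P : ChainItem) (ζ : ℂ) : ℂ × ℂ :=
  (P.τ ζ - Q.τ ζ - ((res u Q + res u P : ℝ) : ℂ), P.ς ζ - Q.ς ζ)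

/-- At a real angle `τ` is the real time coordinate. [folklore] -/
theorem τ_ofReal (P : ChainItem) (θ : ℝ) : P.τ θ = (P.t θ : ℂ) := by
  simp [τ, t]

/-- At a real angle `ς` is the real transverse coordinate. [folklore] -/
theorem ς_ofReal (P : ChainItem) (θ : ℝ) : P.ς θ = (P.s θ : ℂ) := by
  simp [ς, s]

/-- `τ` is entire. [folklore] -/
theorem differentiable_τ (P : ChainItem) : Differentiable ℂ P.τ := by
  unfold τ; fun_prop

/-- `ς` is entire. [folklore] -/
theorem differentiable_ς (P : ChainItem) : Differentiable ℂ P.ς := by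
  unfold ς; fun_prop

/-- `τ` has real Taylor coefficients: `τ(conj ζ) = conj τ(ζ)`. [folklore] -/
theorem τ_conj (P : ChainItem) (ζ : ℂ) : P.τ (conj ζ) = conj (P.τ ζ) := by
  simp [τ, Complex.cos_conj, Complex.sin_conj, Complex.conj_ofReal]

/-- `ς` has real Taylor coefficients: `ς(conj ζ) = conj ς(ζ)`. [folklore] -/
theorem ς_conj (P : ChainItem) (ζ : ℂ) : P.ς (conj ζ) = conj (P.ς ζ) := by
  simp [ς, Complex.cos_conj, Complex.sin_conj, Complex.conj_ofReal]

/-- The reservation is at most `u` (for `u ≥ 0`). [folklore] -/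
theorem res_le {u : ℝ} (hu : 0 ≤ u) (P : ChainItem) : res u P ≤ u := by
  unfold res; split_ifs <;> linarith

/-- The reservation is nonnegative (for `u ≥ 0`). [folklore] -/
theorem res_nonneg {u : ℝ} (hu : 0 ≤ u) (P : ChainItem) : 0 ≤ res u P := by
  unfold res; split_ifs <;> linarith

/-- The gap at a real angle is real. [folklore] -/
theorem gap_ofReal (u : ℝ) (Q P : ChainItem) (θ : ℝ) :
    gap u Q P θ = (((P.t θ - Q.t θ - (res u Q + res u P) : ℝ) : ℂ), ((P.s θ - Q.s θ : ℝ) : ℂ)) := by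
  simp only [gap, τ_ofReal, ς_ofReal]
  push_cast
  ring_nf

/-- The gap at the conjugate angle is the conjugate gap. [folklore] -/
theorem gap_conj (u : ℝ) (Q P : ChainItem) (ζ : ℂ) :
    gap u Q P (conj ζ) = (conj (gap u Q P ζ).1, conj (gap u Q P ζ).2) := by
  simp only [gap, τ_conj, ς_conj, map_sub, Complex.conj_ofReal]

/-- The gap is entire in the angle. [folklore] -/
theorem differentiable_gap (u : ℝ) (Q P : ChainItem) : Differentiable ℂ (gap u Q P) := by
  unfold gap
  exact (((differentiable_τ P).sub (differentiable_τ Q)).sub (differentiable_const _)).prodMk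
    ((differentiable_ς P).sub (differentiable_ς Q))

/-- Real part of `cos`. [folklore] -/
theorem cos_re (z : ℂ) : (Complex.cos z).re = Real.cos z.re * Real.cosh z.im := by
  rw [Complex.cos_eq]
  simp [Complex.cos_ofReal_re, Complex.cosh_ofReal_re, Complex.sin_ofReal_re, Complex.sinh_ofReal_re,
    Complex.cos_ofReal_im, Complex.cosh_ofReal_im, Complex.sin_ofReal_im, Complex.sinh_ofReal_im,
    Complex.mul_re, Complex.mul_im]

/-- Real part of `sin`. [folklore] -/
theorem sin_re (z : ℂ) : (Complex.sin z).re = Real.sin z.re * Real.cosh z.im := by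
  rw [Complex.sin_eq]
  simp [Complex.cos_ofReal_re, Complex.cosh_ofReal_re, Complex.sin_ofReal_re, Complex.sinh_ofReal_re,
    Complex.cos_ofReal_im, Complex.cosh_ofReal_im, Complex.sin_ofReal_im, Complex.sinh_ofReal_im,
    Complex.mul_re, Complex.mul_im]

/-- Imaginary part of `cos`. [folklore] -/
theorem cos_im (z : ℂ) : (Complex.cos z).im = -(Real.sin z.re * Real.sinh z.im) := by
  rw [Complex.cos_eq]
  simp [Complex.cos_ofReal_re, Complex.cosh_ofReal_re, Complex.sin_ofReal_re, Complex.sinh_ofReal_re,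
    Complex.cos_ofReal_im, Complex.cosh_ofReal_im, Complex.sin_ofReal_im, Complex.sinh_ofReal_im,
    Complex.mul_re, Complex.mul_im]

/-- Imaginary part of `sin`. [folklore] -/
theorem sin_im (z : ℂ) : (Complex.sin z).im = Real.cos z.re * Real.sinh z.im := by
  rw [Complex.sin_eq]
  simp [Complex.cos_ofReal_re, Complex.cosh_ofReal_re, Complex.sin_ofReal_re, Complex.sinh_ofReal_re,
    Complex.cos_ofReal_im, Complex.cosh_ofReal_im, Complex.sin_ofReal_im, Complex.sinh_ofReal_im,
    Complex.mul_re, Complex.mul_im]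

/-- **A complex angle boosts the time gaps**: `Re (τ_P - τ_Q)(ζ) = cosh (Im ζ) · (t_P - t_Q)(Re ζ)`. [folklore] -/
theorem re_τ_sub (Q P : ChainItem) (ζ : ℂ) :
    (P.τ ζ).re - (Q.τ ζ).re = Real.cosh ζ.im * (P.t ζ.re - Q.t ζ.re) := by
  simp only [τ, t, Complex.add_re, Complex.mul_re, cos_re, sin_re, cos_im, sin_im,
    Complex.ofReal_re, Complex.ofReal_im]
  ring

/-- **A complex angle tilts the transverse gaps into the imaginary direction**:
`Im (ς_P - ς_Q)(ζ) = -sinh (Im ζ) · (t_P - t_Q)(Re ζ)`. [folklore] -/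
theorem im_ς_sub (Q P : ChainItem) (ζ : ℂ) :
    (P.ς ζ).im - (Q.ς ζ).im = -(Real.sinh ζ.im * (P.t ζ.re - Q.t ζ.re)) := by
  simp only [ς, t, Complex.add_im, Complex.mul_im, Complex.neg_re, Complex.neg_im,
    cos_re, sin_re, cos_im, sin_im, Complex.ofReal_re, Complex.ofReal_im]
  ring

/-- `cosh χ - |sinh χ| = e^{-|χ|}`. [folklore] -/
theorem cosh_sub_abs_sinh (χ : ℝ) : Real.cosh χ - |Real.sinh χ| = Real.exp (-|χ|) := by
  rw [Real.abs_sinh, ← Real.cosh_abs χ, Real.cosh_sub_sinh]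

/-- **The gap stays in the tube** (speed one is exactly the threshold): if the real time gap at the
angle `Re ζ` is at least `h > 0`, `|Im ζ| < R` and the reservations satisfy `2u ≤ e^{-R} h`, then
`|Im Δς| < Re Δτ - reserved`. [folklore] -/
theorem gap_mem_tube {u h R : ℝ} (hu : 0 ≤ u) (hh : 0 < h) (huR : 2 * u ≤ Real.exp (-R) * h)
    {Q P : ChainItem} {ζ : ℂ} (hg : h ≤ P.t ζ.re - Q.t ζ.re) (hζ : |ζ.im| < R) :
    |(gap u Q P ζ).2.im| < (gap u Q P ζ).1.re := by
  simp only [gap, Complex.sub_re, Complex.sub_im, Complex.ofReal_re]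
  rw [re_τ_sub, im_ς_sub, abs_neg, abs_mul]
  set g := P.t ζ.re - Q.t ζ.re with hg'
  have hg0 : 0 < g := hh.trans_le hg
  rw [abs_of_pos hg0]
  have hres : res u Q + res u P ≤ 2 * u := by
    have := res_le hu Q; have := res_le hu P; linarith
  have hexp : Real.exp (-R) < Real.exp (-|ζ.im|) := Real.exp_lt_exp.2 (by linarith)
  have key : Real.exp (-R) * h < Real.exp (-|ζ.im|) * g :=
    calc Real.exp (-R) * h < Real.exp (-|ζ.im|) * h := by gcongr
      _ ≤ Real.exp (-|ζ.im|) * g := by gcongr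
  have := cosh_sub_abs_sinh ζ.im
  nlinarith [this, key, abs_nonneg (Real.sinh ζ.im)]

/-- At a real angle the tube condition is positivity of the reserved gap. [folklore] -/
theorem gap_mem_tube_ofReal {u : ℝ} {Q P : ChainItem} {θ : ℝ} (h : res u Q + res u P < P.t θ - Q.t θ) :
    |(gap u Q P θ).2.im| < (gap u Q P θ).1.re := by
  rw [gap_ofReal]
  simp only [Complex.ofReal_im, abs_zero, Complex.ofReal_re]
  linarith

end ChainItem

open ChainItem

/-! ## Chains of gap operators and insertions -/

variable {X : Type*} {H : Type*} [NormedAddCommGroup H] [InnerProductSpace ℂ H]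

/-- **The chain operator** of a list of items seen from a reference item `Q`: for `P :: L`,
`N(gap(Q, P)) ∘ B_P ∘ chainOp L P` with `B_P = B w_P` if `P` is inserted and `1` if virtual; the
empty chain is the identity. (Glimm–Jaffe §19.5–19.7: products of holomorphic semigroup factors and
field insertions.) [cite: GlimmJaffe1987, §19.5–19.7] -/
def chainOp (N : ℂ × ℂ → (H →L[ℂ] H)) (B : ℝ → (H →L[ℂ] H)) (u : ℝ) :
    List ChainItem → ChainItem → ℂ → (H →L[ℂ] H)
  | [], _, _ => 1
  | P :: L, Q, ζ => N (gap u Q P ζ) * ((if P.ins then B P.w else 1) * chainOp N B u L P ζ)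

/-- **The index reached by a chain at a real angle**, when `N(t, y)` relabels kernel vectors by
`σ t y` and `B w` by `κ w`, starting from the index `x`. [folklore] -/
def chainCfg (σ : ℝ → ℝ → X → X) (κ : ℝ → X → X) (u : ℝ) :
    List ChainItem → ChainItem → ℝ → X → X
  | [], _, _, x => x
  | P :: L, Q, θ, x => σ (P.t θ - Q.t θ - (res u Q + res u P)) (P.s θ - Q.s θ)
      ((if P.ins then κ P.w else id) (chainCfg σ κ u L P θ x))

/-- **Norm holomorphy of chains**: if `N` is norm-holomorphic along holomorphic curves into the tube
and all consecutive gaps of `Q :: L` stay in the tube on the open set `U`, the chain operator is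
holomorphic on `U`. [folklore] -/
theorem differentiableOn_chainOp {N : ℂ × ℂ → (H →L[ℂ] H)} {B : ℝ → (H →L[ℂ] H)} {u : ℝ}
    (hN : ∀ (U : Set ℂ), IsOpen U → ∀ (q : ℂ → ℂ × ℂ), DifferentiableOn ℂ q U →
      (∀ z ∈ U, |(q z).2.im| < (q z).1.re) → DifferentiableOn ℂ (fun z => N (q z)) U)
    {U : Set ℂ} (hU : IsOpen U) :
    ∀ (L : List ChainItem) (Q : ChainItem),
      List.IsChain (fun Q P => ∀ z ∈ U, |(gap u Q P z).2.im| < (gap u Q P z).1.re) (Q :: L) →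
      DifferentiableOn ℂ (chainOp N B u L Q) U
  | [], Q, _ => by
    simp only [chainOp]
    exact differentiableOn_const _
  | P :: L, Q, h => by
    obtain ⟨hQP, hrest⟩ := List.isChain_cons_cons.1 h
    have h1 : DifferentiableOn ℂ (fun z => N (gap u Q P z)) U :=
      hN U hU _ (differentiable_gap u Q P).differentiableOn hQP
    have h2 := differentiableOn_chainOp (B := B) hN hU L P hrest
    show DifferentiableOn ℂ (fun ζ => N (gap u Q P ζ) * ((if P.ins then B P.w else 1) * chainOp N B u L P ζ)) U
    exact h1.mul ((differentiableOn_const _).mul h2)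

/-- **Norm bound for chains**: each item costs at most `C_N · C_B` (`‖N‖ ≤ C_N` on the tube,
`‖B w‖ ≤ C_B`, `C_B ≥ 1`). [folklore] -/
theorem norm_chainOp_apply_le {N : ℂ × ℂ → (H →L[ℂ] H)} {B : ℝ → (H →L[ℂ] H)} {u : ℝ}
    {CN CB : ℝ} (hCN : 0 ≤ CN) (hCB : 1 ≤ CB)
    (hNb : ∀ p : ℂ × ℂ, |p.2.im| < p.1.re → ‖N p‖ ≤ CN) (hBb : ∀ w, ‖B w‖ ≤ CB) :
    ∀ (L : List ChainItem) (Q : ChainItem) (ζ : ℂ),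
      List.IsChain (fun Q P => |(gap u Q P ζ).2.im| < (gap u Q P ζ).1.re) (Q :: L) →
      ∀ φ : H, ‖chainOp N B u L Q ζ φ‖ ≤ (CN * CB) ^ L.length * ‖φ‖
  | [], Q, ζ, _, φ => by simp [chainOp]
  | P :: L, Q, ζ, h, φ => by
    obtain ⟨hQP, hrest⟩ := List.isChain_cons_cons.1 h
    have ih := norm_chainOp_apply_le hCN hCB hNb hBb L P ζ hrest φ
    have hins : ‖(if P.ins then B P.w else (1 : H →L[ℂ] H)) (chainOp N B u L P ζ φ)‖ ≤
        CB * ‖chainOp N B u L P ζ φ‖ := by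
      split_ifs
      · exact (B P.w).le_of_opNorm_le (hBb P.w) _
      · change ‖chainOp N B u L P ζ φ‖ ≤ CB * ‖chainOp N B u L P ζ φ‖
        nlinarith [norm_nonneg (chainOp N B u L P ζ φ)]
    show ‖N (gap u Q P ζ) ((if P.ins then B P.w else 1) (chainOp N B u L P ζ φ))‖ ≤ _
    calc ‖N (gap u Q P ζ) ((if P.ins then B P.w else 1) (chainOp N B u L P ζ φ))‖
        ≤ CN * ‖(if P.ins then B P.w else (1 : H →L[ℂ] H)) (chainOp N B u L P ζ φ)‖ :=
          (N _).le_of_opNorm_le (hNb _ hQP) _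
      _ ≤ CN * (CB * ((CN * CB) ^ L.length * ‖φ‖)) := by gcongr; exact hins.trans (by gcongr)
      _ = (CN * CB) ^ (P :: L).length * ‖φ‖ := by rw [List.length_cons, pow_succ]; ring

/-- **Reality of chains**: `J X(conj ζ) φ = X(ζ) (J φ)` when `J N(p) = N(p̄) J` on the tube, the
insertions commute with `J`, and the gaps at `ζ` lie in the tube. [folklore] -/
theorem conjOp_chainOp_apply [CompleteSpace H] (δ : X → H) {N : ℂ × ℂ → (H →L[ℂ] H)}
    {B : ℝ → (H →L[ℂ] H)} {u : ℝ}
    (hNc : ∀ p : ℂ × ℂ, |p.2.im| < p.1.re → ∀ φ : H,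
      conjOp δ (N p φ) = N (conj p.1, conj p.2) (conjOp δ φ))
    (hBc : ∀ (w : ℝ) (φ : H), conjOp δ (B w φ) = B w (conjOp δ φ)) :
    ∀ (L : List ChainItem) (Q : ChainItem) (ζ : ℂ),
      List.IsChain (fun Q P => |(gap u Q P ζ).2.im| < (gap u Q P ζ).1.re) (Q :: L) →
      ∀ φ : H, conjOp δ (chainOp N B u L Q (conj ζ) φ) = chainOp N B u L Q ζ (conjOp δ φ)
  | [], Q, ζ, _, φ => by simp [chainOp]
  | P :: L, Q, ζ, h, φ => by
    obtain ⟨hQP, hrest⟩ := List.isChain_cons_cons.1 h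
    have ih := conjOp_chainOp_apply δ hNc hBc L P ζ hrest φ
    have hQP' : |(conj (gap u Q P ζ).2).im| < (conj (gap u Q P ζ).1).re := by simpa using hQP
    have hN' : ∀ ψ : H, conjOp δ (N (gap u Q P (conj ζ)) ψ) = N (gap u Q P ζ) (conjOp δ ψ) := by
      intro ψ
      rw [gap_conj, hNc _ hQP' ψ]
      simp
    have hB' : ∀ ψ : H, conjOp δ ((if P.ins then B P.w else (1 : H →L[ℂ] H)) ψ) =
        (if P.ins then B P.w else (1 : H →L[ℂ] H)) (conjOp δ ψ) := by
      intro ψ; split_ifs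
      · exact hBc _ _
      · rfl
    show conjOp δ (N (gap u Q P (conj ζ)) ((if P.ins then B P.w else 1) (chainOp N B u L P (conj ζ) φ))) =
      N (gap u Q P ζ) ((if P.ins then B P.w else 1) (chainOp N B u L P ζ (conjOp δ φ)))
    rw [hN', hB', ih]

/-- **Real angles reproduce kernel vectors**: if `N(t, y) δ_b = δ_{σ t y b}` (`t > 0`) and
`B w δ_b = δ_{κ w b}`, and all reserved gaps at the real angle `θ` are positive, then
`X(θ) δ_x = δ_{chainCfg … θ x}`. [folklore] -/
theorem chainOp_apply_gen (δ : X → H) {N : ℂ × ℂ → (H →L[ℂ] H)} {B : ℝ → (H →L[ℂ] H)} {u : ℝ}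
    (σ : ℝ → ℝ → X → X) (κ : ℝ → X → X)
    (hσ : ∀ t y : ℝ, 0 < t → ∀ b, N ((t : ℂ), (y : ℂ)) (δ b) = δ (σ t y b))
    (hκ : ∀ (w : ℝ) (b : X), B w (δ b) = δ (κ w b)) :
    ∀ (L : List ChainItem) (Q : ChainItem) (θ : ℝ),
      List.IsChain (fun Q P => res u Q + res u P < P.t θ - Q.t θ) (Q :: L) →
      ∀ x : X, chainOp N B u L Q θ (δ x) = δ (chainCfg σ κ u L Q θ x)
  | [], Q, θ, _, x => by simp [chainOp, chainCfg]
  | P :: L, Q, θ, h, x => by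
    obtain ⟨hQP, hrest⟩ := List.isChain_cons_cons.1 h
    have ih := chainOp_apply_gen δ σ κ hσ hκ L P θ hrest x
    have hB' : (if P.ins then B P.w else (1 : H →L[ℂ] H)) (δ (chainCfg σ κ u L P θ x)) =
        δ ((if P.ins then κ P.w else id) (chainCfg σ κ u L P θ x)) := by
      split_ifs
      · exact hκ _ _
      · rfl
    show N (gap u Q P θ) ((if P.ins then B P.w else 1) (chainOp N B u L P θ (δ x))) =
      δ (σ (P.t θ - Q.t θ - (res u Q + res u P)) (P.s θ - Q.s θ)
        ((if P.ins then κ P.w else id) (chainCfg σ κ u L P θ x)))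
    rw [ih, hB', gap_ofReal, hσ _ _ (by linarith)]

end Literature.MathematicalPhysics.QuantumFieldTheory
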